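import Mathlib
import Literature.Computability.AlgebraicComplexity.MatrixMultiplicationExponent

/-!
# Probe-rank-certified decompositions of `⟨n,n,n⟩` — machinery for `FixedRankSaturation`
# (route ProbeRankThreshold, item stmt-MatrixMultiplication-6606)

Support file for `ProbeRankThreshold.FixedRankSaturation` (for every `k`, `ε > 0` and all large
`n`, `⟨n,n,n⟩` has a decomposition into `≤ (1+ε) n³/2^k` triads all of whose legs, read as
`n × n` matrices — the PROBES — have rank `≤ 2^k`), proved in the sibling file
`ProbeRankThresholdFixedRankSaturation.lean`.

We work with the matrix multiplication tensor `mmT α` on an arbitrary finite index type `α`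
(definitionally `matMulTensor ℂ n n n` for `α = Fin n`, `mmT_fin`) and with decompositions
`mmT α = ∑ s, triad (w s) (u s) (v s)` whose legs carry an explicit LOW-RANK CERTIFICATE
`IsLowRank ρ f`: a factorisation `f (p, q) = ∑ t, P p t * Q t q` through a type of cardinality
`≤ ρ` (so the probe has matrix rank `≤ ρ`, `IsLowRank.rank_le`, by `Matrix.rank_mul_le_left`).
Certificates — unlike bare rank bounds — are stable under everything the construction needs,
with no matrix-rank theory:

* `HasDecomp.kron`: the Kronecker product of certified decompositions of `⟨α⟩` and `⟨β⟩` is a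
  certified decomposition of `⟨α × β⟩`; term index types and certificate sizes multiply;
* `HasDecomp.comap` / `HasDecomp.restrict`: restriction along an injection `β ↪ α`
  (zero-padding monotonicity: `n ≤ N ⇒` a scheme for `⟨N⟩` restricts to one for `⟨n⟩` with
  the same terms and certificates — the probes become submatrices);
* `HasDecomp.pow`: `k`-th Kronecker power, `⟨N^k⟩` in `r^k` terms with certificates `ρ^k`;
* `hasDecompTrivial`: the standard algorithm (`|α|³` terms, certificates `1`);
* `mmT_eq_of_forms`: a tensor identity follows from the identity of trilinear forms
  `∑ z_{κν} x_{κμ} y_{μν} = ∑_s ⟨w_s, z⟩ ⟨u_s, x⟩ ⟨v_s, y⟩` (how Pan's aggregation design is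
  verified in the sibling file), with the pairings of matrix units / row segments / column
  segments (`pair_unitLeg`, `pair_rowLeg`, `pair_colLeg`);
* `HasDecomp.toFin`: back to the route's vocabulary (`matMulTensor`, `Matrix.rank`).

References: V. Ya. Pan, *How to multiply matrices faster*, LNCS 179 (1984), §4 (trilinear
aggregating) [Pan1984]; M. Bläser, *Fast Matrix Multiplication*, ToC Graduate Surveys 5 (2013),
§4–5 (tensor conventions) [Blaser2013].  No statement of the route is asserted here.
-/

-- single-conjunct summit: the `Summit.<S>.<P>` prefix repeats `MatrixMultiplication` by design (D-0017)
set_option linter.dupNamespace false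

noncomputable section

open scoped BigOperators
open Literature.Computability.AlgebraicComplexity

namespace Summit.MatrixMultiplication.MatrixMultiplication.Theorems

namespace FixedRankSaturation

/-! ### The tensor `⟨α, α, α⟩` on a general index type -/

/-- The matrix multiplication tensor `⟨α,α,α⟩` with rows/columns indexed by a finite type `α`:
slot A = `(κ,ν)` (entry of the product), slot B = `(κ',μ)` (left factor), slot C = `(μ',ν')`
(right factor); entry `1` iff `κ = κ'`, `μ = μ'`, `ν = ν'` (Bläser 2013, §5). -/
def mmT (α : Type) [DecidableEq α] : α × α → α × α → α × α → ℂ :=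
  fun a b c => if a.1 = b.1 ∧ b.2 = c.1 ∧ a.2 = c.2 then 1 else 0

/-- `mmT (Fin n)` is literally the route's `matMulTensor ℂ n n n`. -/
theorem mmT_fin (n : ℕ) : mmT (Fin n) = matMulTensor ℂ n n n := rfl

/-- Entries of a sum of triads. -/
theorem sum_triad_apply {σ X Y Z : Type} [Fintype σ] (w : σ → X → ℂ) (u : σ → Y → ℂ)
    (v : σ → Z → ℂ) (a : X) (b : Y) (c : Z) :
    (∑ s, triad (w s) (u s) (v s)) a b c = ∑ s, w s a * u s b * v s c := by
  simp [Finset.sum_apply, triad_apply]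

/-- `⟨α × β⟩` is the Kronecker product of `⟨α⟩` and `⟨β⟩` (entrywise). -/
theorem mmT_prod {α β : Type} [DecidableEq α] [DecidableEq β] (A B C : (α × β) × (α × β)) :
    mmT (α × β) A B C = mmT α (A.1.1, A.2.1) (B.1.1, B.2.1) (C.1.1, C.2.1) *
      mmT β (A.1.2, A.2.2) (B.1.2, B.2.2) (C.1.2, C.2.2) := by
  simp only [mmT, Prod.ext_iff, ite_zero_mul_ite_zero, mul_one]
  exact if_congr (by tauto) rfl rfl

/-- `⟨β⟩` is the restriction of `⟨α⟩` along any injection `β → α`. -/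
theorem mmT_comap {α β : Type} [DecidableEq α] [DecidableEq β] (g : β → α)
    (hg : Function.Injective g) (A B C : β × β) :
    mmT β A B C = mmT α (g A.1, g A.2) (g B.1, g B.2) (g C.1, g C.2) := by
  simp only [mmT, hg.eq_iff]

/-! ### Low-rank certificates -/

/-- A low-rank CERTIFICATE for `f : α × α → ℂ` read as an `α × α` matrix: an explicit
factorisation through a finite type of cardinality `≤ ρ`. -/
def IsLowRank {α : Type} (ρ : ℕ) (f : α × α → ℂ) : Prop :=
  ∃ (τ : Type) (_ : Fintype τ) (P : α → τ → ℂ) (Q : τ → α → ℂ),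
    Fintype.card τ ≤ ρ ∧ ∀ p q, f (p, q) = ∑ t, P p t * Q t q

/-- A certificate bounds the matrix rank of the probe (the form used by the route). -/
theorem IsLowRank.rank_le {n ρ : ℕ} {f : Fin n × Fin n → ℂ} (h : IsLowRank ρ f) :
    (Matrix.of fun p q => f (p, q)).rank ≤ ρ := by
  obtain ⟨τ, _, P, Q, hcard, hf⟩ := h
  have hmul : (Matrix.of fun p q => f (p, q)) = Matrix.of P * Matrix.of Q := by
    ext p q
    simp [Matrix.mul_apply, hf]
  rw [hmul]
  exact (Matrix.rank_mul_le_left _ _).trans ((Matrix.rank_le_card_width _).trans hcard)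

/-- Certificates are monotone in the bound. -/
theorem IsLowRank.mono {α : Type} {ρ ρ' : ℕ} {f : α × α → ℂ} (h : IsLowRank ρ f) (hle : ρ ≤ ρ') :
    IsLowRank ρ' f := by
  obtain ⟨τ, _, P, Q, hcard, hf⟩ := h
  exact ⟨τ, inferInstance, P, Q, hcard.trans hle, hf⟩

/-- Certificates add under addition of legs. -/
theorem IsLowRank.add {α : Type} {ρ ρ' : ℕ} {f g : α × α → ℂ} (hf : IsLowRank ρ f)
    (hg : IsLowRank ρ' g) : IsLowRank (ρ + ρ') (f + g) := by
  obtain ⟨τ, _, P, Q, hcard, hf⟩ := hf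
  obtain ⟨τ', _, P', Q', hcard', hg⟩ := hg
  refine ⟨τ ⊕ τ', inferInstance, fun p => Sum.elim (P p) (P' p),
    Sum.elim Q Q', ?_, fun p q => ?_⟩
  · rw [Fintype.card_sum]; exact Nat.add_le_add hcard hcard'
  · simp [Fintype.sum_sum_type, hf, hg]

/-- Certificates are preserved by negation. -/
theorem IsLowRank.neg {α : Type} {ρ : ℕ} {f : α × α → ℂ} (hf : IsLowRank ρ f) : IsLowRank ρ (-f) := by
  obtain ⟨τ, _, P, Q, hcard, hf⟩ := hf
  refine ⟨τ, inferInstance, fun p t => -P p t, Q, hcard, fun p q => ?_⟩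
  simp [hf, Finset.sum_neg_distrib, neg_mul]

/-- Certificates restrict along any map of index types (submatrix). -/
theorem IsLowRank.comap {α β : Type} {ρ : ℕ} {f : α × α → ℂ} (g : β → α) (hf : IsLowRank ρ f) :
    IsLowRank ρ (fun A : β × β => f (g A.1, g A.2)) := by
  obtain ⟨τ, _, P, Q, hcard, hf⟩ := hf
  exact ⟨τ, inferInstance, fun p t => P (g p) t, fun t q => Q t (g q), hcard, fun p q => hf _ _⟩

/-- Certificates multiply under the Kronecker product of legs. -/
theorem IsLowRank.kron {α β : Type} {ρ ρ' : ℕ} {f : α × α → ℂ} {g : β × β → ℂ}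
    (hf : IsLowRank ρ f) (hg : IsLowRank ρ' g) :
    IsLowRank (ρ * ρ') (fun A : (α × β) × (α × β) => f (A.1.1, A.2.1) * g (A.1.2, A.2.2)) := by
  obtain ⟨τ, _, P, Q, hcard, hf⟩ := hf
  obtain ⟨τ', _, P', Q', hcard', hg⟩ := hg
  refine ⟨τ × τ', inferInstance, fun p t => P p.1 t.1 * P' p.2 t.2,
    fun t q => Q t.1 q.1 * Q' t.2 q.2, ?_, fun p q => ?_⟩
  · rw [Fintype.card_prod]; exact Nat.mul_le_mul hcard hcard'
  · simp only [hf, hg, Finset.sum_mul_sum, Fintype.sum_prod_type]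
    exact Finset.sum_congr rfl fun _ _ => Finset.sum_congr rfl fun _ _ => by ring

/-- A product of a row indicator and a column indicator has a certificate of size `1`. -/
theorem isLowRank_indicator {α : Type} (S T : α → Prop) [DecidablePred S] [DecidablePred T] :
    IsLowRank 1 (fun A : α × α => (if S A.1 then 1 else 0) * (if T A.2 then 1 else 0)) :=
  ⟨Unit, inferInstance, fun p _ => if S p then 1 else 0, fun _ q => if T q then 1 else 0,
    by simp, fun p q => by simp⟩

/-! ### Trilinear forms: a tensor identity from an identity of forms -/

/-- The trilinear form of a tensor against test vectors (`z` on slot A, `x` on B, `y` on C). -/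
def form {X Y Z : Type} [Fintype X] [Fintype Y] [Fintype Z] (T : X → Y → Z → ℂ) (z : X → ℂ)
    (x : Y → ℂ) (y : Z → ℂ) : ℂ :=
  ∑ a, ∑ b, ∑ c, T a b c * (z a * x b * y c)

/-- Tensors with equal trilinear forms are equal (test against indicator vectors). -/
theorem eq_of_form_eq {X Y Z : Type} [Fintype X] [Fintype Y] [Fintype Z] [DecidableEq X]
    [DecidableEq Y] [DecidableEq Z] (T T' : X → Y → Z → ℂ)
    (h : ∀ z x y, form T z x y = form T' z x y) : T = T' := by
  funext a b c
  have key := h (fun a' => if a = a' then 1 else 0) (fun b' => if b = b' then 1 else 0)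
    (fun c' => if c = c' then 1 else 0)
  simpa [form, mul_ite, ite_and, Finset.sum_ite_eq] using key

/-- The trilinear form of `⟨α⟩`: `∑_{κ μ ν} z_{κν} x_{κμ} y_{μν}` (the trace form). -/
theorem form_mmT {α : Type} [Fintype α] [DecidableEq α] (z x y : α × α → ℂ) :
    form (mmT α) z x y = ∑ κ, ∑ μ, ∑ ν, z (κ, ν) * x (κ, μ) * y (μ, ν) := by
  simp only [form, mmT, boole_mul]
  simp only [Fintype.sum_prod_type, ite_and, Finset.sum_ite_irrel, Finset.sum_const_zero,
    Finset.sum_ite_eq, Finset.mem_univ, if_true]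
  exact Finset.sum_congr rfl fun _ _ => Finset.sum_comm

/-- The trilinear form of a single triad: `⟨w, z⟩ ⟨u, x⟩ ⟨v, y⟩`. -/
theorem form_triad {X Y Z : Type} [Fintype X] [Fintype Y] [Fintype Z] (w : X → ℂ) (u : Y → ℂ)
    (v : Z → ℂ) (z : X → ℂ) (x : Y → ℂ) (y : Z → ℂ) :
    form (triad w u v) z x y = (∑ a, w a * z a) * (∑ b, u b * x b) * (∑ c, v c * y c) := by
  unfold form
  rw [Finset.sum_mul_sum, Finset.sum_mul]
  refine Finset.sum_congr rfl fun a _ => ?_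
  rw [Finset.sum_mul]
  refine Finset.sum_congr rfl fun b _ => ?_
  rw [Finset.mul_sum]
  refine Finset.sum_congr rfl fun c _ => ?_
  rw [triad_apply]
  ring

/-- The trilinear form of a sum of triads: `∑_s ⟨w_s, z⟩ ⟨u_s, x⟩ ⟨v_s, y⟩`. -/
theorem form_sum_triad {σ X Y Z : Type} [Fintype σ] [Fintype X] [Fintype Y] [Fintype Z]
    (w : σ → X → ℂ) (u : σ → Y → ℂ) (v : σ → Z → ℂ) (z : X → ℂ) (x : Y → ℂ) (y : Z → ℂ) :
    form ((∑ s, triad (w s) (u s) (v s) : X → Y → Z → ℂ)) z x y =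
      ∑ s, (∑ a, w s a * z a) * (∑ b, u s b * x b) * (∑ c, v s c * y c) := by
  -- the form is additive in the tensor: package it as an additive monoid hom and use `map_sum`
  let Φ : (X → Y → Z → ℂ) →+ ℂ :=
    { toFun := fun T => form T z x y
      map_zero' := by simp [form]
      map_add' := fun T T' => by
        simp only [form, Pi.add_apply, add_mul, Finset.sum_add_distrib] }
  have h := map_sum Φ (fun s => triad (w s) (u s) (v s)) Finset.univ
  simp only [Φ, AddMonoidHom.coe_mk, ZeroHom.coe_mk, form_triad] at h
  exact h

/-- A decomposition of `⟨α⟩` from the identity of trilinear forms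
`∑ z_{κν} x_{κμ} y_{μν} = ∑_s ⟨w_s, z⟩ ⟨u_s, x⟩ ⟨v_s, y⟩`. -/
theorem mmT_eq_of_forms {α σ : Type} [Fintype α] [DecidableEq α] [Fintype σ]
    (w u v : σ → α × α → ℂ)
    (h : ∀ z x y : α × α → ℂ, ∑ κ, ∑ μ, ∑ ν, z (κ, ν) * x (κ, μ) * y (μ, ν) =
      ∑ s, (∑ a, w s a * z a) * (∑ b, u s b * x b) * (∑ c, v s c * y c)) :
    mmT α = ∑ s, triad (w s) (u s) (v s) :=
  eq_of_form_eq _ _ fun z x y => by rw [form_mmT, form_sum_triad, h]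

/-! ### Certified decompositions -/

/-- `HasDecomp α σ ρ`: `⟨α,α,α⟩` is a sum of triads indexed by `σ`, every leg carrying a low-rank
certificate of size `ρ`. -/
def HasDecomp (α : Type) [DecidableEq α] (σ : Type) [Fintype σ] (ρ : ℕ) : Prop :=
  ∃ (w u v : σ → α × α → ℂ), mmT α = ∑ s, triad (w s) (u s) (v s) ∧
    ∀ s, IsLowRank ρ (w s) ∧ IsLowRank ρ (u s) ∧ IsLowRank ρ (v s)

/-- Reindex the terms of a decomposition. -/
theorem HasDecomp.reindex {α σ σ' : Type} [DecidableEq α] [Fintype σ] [Fintype σ'] {ρ : ℕ}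
    (h : HasDecomp α σ ρ) (e : σ ≃ σ') : HasDecomp α σ' ρ := by
  obtain ⟨w, u, v, he, hr⟩ := h
  refine ⟨fun s => w (e.symm s), fun s => u (e.symm s), fun s => v (e.symm s), ?_,
    fun s => hr (e.symm s)⟩
  rw [he]
  exact Fintype.sum_equiv e _ _ fun s => by simp

/-- Restrict a decomposition of `⟨α⟩` along an injection `β → α` (zero-padding monotonicity:
`⟨β⟩` inherits the scheme with the same number of terms and the same certificates). -/
theorem HasDecomp.comap {α β σ : Type} [DecidableEq α] [DecidableEq β] [Fintype σ] {ρ : ℕ}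
    (h : HasDecomp α σ ρ) (g : β → α) (hg : Function.Injective g) : HasDecomp β σ ρ := by
  obtain ⟨w, u, v, he, hr⟩ := h
  refine ⟨fun s A => w s (g A.1, g A.2), fun s A => u s (g A.1, g A.2),
    fun s A => v s (g A.1, g A.2), ?_,
    fun s => ⟨(hr s).1.comap g, (hr s).2.1.comap g, (hr s).2.2.comap g⟩⟩
  funext A B C
  rw [mmT_comap g hg, he, sum_triad_apply, sum_triad_apply]

/-- Kronecker product of certified decompositions: `⟨α × β⟩` from `⟨α⟩` and `⟨β⟩`; the term
index types and the certificate sizes multiply. -/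
theorem HasDecomp.kron {α β σ τ : Type} [DecidableEq α] [DecidableEq β] [Fintype σ] [Fintype τ]
    {ρ ρ' : ℕ} (h₁ : HasDecomp α σ ρ) (h₂ : HasDecomp β τ ρ') :
    HasDecomp (α × β) (σ × τ) (ρ * ρ') := by
  obtain ⟨w, u, v, he, hr⟩ := h₁
  obtain ⟨w', u', v', he', hr'⟩ := h₂
  refine ⟨fun s A => w s.1 (A.1.1, A.2.1) * w' s.2 (A.1.2, A.2.2),
    fun s A => u s.1 (A.1.1, A.2.1) * u' s.2 (A.1.2, A.2.2),
    fun s A => v s.1 (A.1.1, A.2.1) * v' s.2 (A.1.2, A.2.2), ?_,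
    fun s => ⟨(hr s.1).1.kron (hr' s.2).1, (hr s.1).2.1.kron (hr' s.2).2.1,
      (hr s.1).2.2.kron (hr' s.2).2.2⟩⟩
  funext A B C
  rw [mmT_prod, he, he', sum_triad_apply, sum_triad_apply, sum_triad_apply, Finset.sum_mul_sum,
    Fintype.sum_prod_type]
  exact Finset.sum_congr rfl fun _ _ => Finset.sum_congr rfl fun _ _ => by ring

/-! ### The standard algorithm and Kronecker powers -/

/-- The matrix unit `E_{pq}` as a leg, written as (row indicator) · (column indicator). -/
def unitLeg {α : Type} [DecidableEq α] (p q : α) : α × α → ℂ :=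
  fun A => (if A.1 = p then 1 else 0) * (if A.2 = q then 1 else 0)

/-- Pairing a matrix unit against a test vector evaluates it. -/
theorem pair_unitLeg {α : Type} [Fintype α] [DecidableEq α] (p q : α) (x : α × α → ℂ) :
    ∑ A, unitLeg p q A * x A = x (p, q) := by
  simp [unitLeg, Fintype.sum_prod_type, Finset.sum_ite_eq', mul_ite, ite_mul]

/-- Matrix units have certificates of size `1`. -/
theorem isLowRank_unitLeg {α : Type} [DecidableEq α] (p q : α) : IsLowRank 1 (unitLeg p q) :=
  isLowRank_indicator (· = p) (· = q)

/-- A row segment as a leg on a block-structured index type `β × γ`: the indicator of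
row `p` restricted to the column block `J` (rank one: row indicator · column-block indicator). -/
def rowLeg {β γ : Type} [DecidableEq β] [DecidableEq γ] (p : β × γ) (J : β) :
    (β × γ) × (β × γ) → ℂ :=
  fun A => (if A.1 = p then 1 else 0) * (if A.2.1 = J then 1 else 0)

/-- A column segment as a leg on `β × γ`: the indicator of column `q` restricted to the row
block `I`. -/
def colLeg {β γ : Type} [DecidableEq β] [DecidableEq γ] (I : β) (q : β × γ) :
    (β × γ) × (β × γ) → ℂ :=
  fun A => (if A.1.1 = I then 1 else 0) * (if A.2 = q then 1 else 0)

/-- Pairing a row segment against a test vector sums the row over the column block. -/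
theorem pair_rowLeg {β γ : Type} [Fintype β] [Fintype γ] [DecidableEq β] [DecidableEq γ]
    (p : β × γ) (J : β) (x : (β × γ) × (β × γ) → ℂ) :
    ∑ A, rowLeg p J A * x A = ∑ k, x (p, (J, k)) := by
  rw [Fintype.sum_prod_type, Finset.sum_eq_single_of_mem p (Finset.mem_univ _)]
  · rw [Fintype.sum_prod_type, Finset.sum_eq_single_of_mem J (Finset.mem_univ _)]
    · exact Finset.sum_congr rfl fun k _ => by simp [rowLeg]
    · intro b _ hb
      simp [rowLeg, hb]
  · intro a _ ha
    simp [rowLeg, ha]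

/-- Pairing a column segment against a test vector sums the column over the row block. -/
theorem pair_colLeg {β γ : Type} [Fintype β] [Fintype γ] [DecidableEq β] [DecidableEq γ]
    (I : β) (q : β × γ) (x : (β × γ) × (β × γ) → ℂ) :
    ∑ A, colLeg I q A * x A = ∑ k, x ((I, k), q) := by
  rw [Fintype.sum_prod_type, Fintype.sum_prod_type,
    Finset.sum_eq_single_of_mem I (Finset.mem_univ _)]
  · refine Finset.sum_congr rfl fun k _ => ?_
    rw [Finset.sum_eq_single_of_mem q (Finset.mem_univ _)]
    · simp [colLeg]
    · intro b _ hb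
      simp [colLeg, hb]
  · intro a _ ha
    simp [colLeg, ha]

/-- Row segments have certificates of size `1`. -/
theorem isLowRank_rowLeg {β γ : Type} [DecidableEq β] [DecidableEq γ] (p : β × γ) (J : β) :
    IsLowRank 1 (rowLeg p J) :=
  isLowRank_indicator (· = p) (fun q : β × γ => q.1 = J)

/-- Column segments have certificates of size `1`. -/
theorem isLowRank_colLeg {β γ : Type} [DecidableEq β] [DecidableEq γ] (I : β) (q : β × γ) :
    IsLowRank 1 (colLeg I q) :=
  isLowRank_indicator (fun p : β × γ => p.1 = I) (· = q)

/-- The standard algorithm `⟨α⟩ = ∑_{κ μ ν} E_{κν} ⊗ E_{κμ} ⊗ E_{μν}`: `|α|³` terms, all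
certificates of size `1`. -/
theorem hasDecompTrivial (α : Type) [Fintype α] [DecidableEq α] : HasDecomp α (α × α × α) 1 := by
  refine ⟨fun s => unitLeg s.1 s.2.2, fun s => unitLeg s.1 s.2.1, fun s => unitLeg s.2.1 s.2.2,
    ?_, fun s => ⟨isLowRank_unitLeg _ _, isLowRank_unitLeg _ _, isLowRank_unitLeg _ _⟩⟩
  refine mmT_eq_of_forms _ _ _ fun z x y => ?_
  simp only [pair_unitLeg]
  simp only [Fintype.sum_prod_type]

/-- The one-point case `⟨1⟩`: one term, certificates `1` (base of the Kronecker induction). -/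
theorem hasDecompOne : HasDecomp (Fin 1) (Fin 1) 1 :=
  (hasDecompTrivial (Fin 1)).reindex (Fintype.equivOfCardEq (by simp))

/-- Kronecker powers: a certified decomposition of `⟨N⟩` with `r` terms and certificates `ρ`
gives one of `⟨N^k⟩` with `r^k` terms and certificates `ρ^k`. -/
theorem HasDecomp.pow {N r ρ : ℕ} (h : HasDecomp (Fin N) (Fin r) ρ) (k : ℕ) :
    HasDecomp (Fin (N ^ k)) (Fin (r ^ k)) (ρ ^ k) := by
  induction k with
  | zero => simpa using hasDecompOne
  | succ k ih =>
    exact ((ih.kron h).comap finProdFinEquiv.symm finProdFinEquiv.symm.injective).reindex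
      finProdFinEquiv

/-! ### Back to the route's vocabulary -/

/-- A certified decomposition of `⟨Fin n⟩` indexed by `Fin r` is a decomposition of
`matMulTensor ℂ n n n` into `r` triads all of whose probes have rank `≤ ρ`. -/
theorem HasDecomp.toFin {n r ρ : ℕ} (h : HasDecomp (Fin n) (Fin r) ρ) :
    ∃ (w u v : Fin r → Fin n × Fin n → ℂ),
      matMulTensor ℂ n n n = ∑ i, triad (w i) (u i) (v i) ∧
      ∀ i, (Matrix.of fun p q => w i (p, q)).rank ≤ ρ ∧
        (Matrix.of fun p q => u i (p, q)).rank ≤ ρ ∧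
        (Matrix.of fun p q => v i (p, q)).rank ≤ ρ := by
  obtain ⟨w, u, v, he, hr⟩ := h
  exact ⟨w, u, v, (mmT_fin n).symm.trans he,
    fun i => ⟨(hr i).1.rank_le, (hr i).2.1.rank_le, (hr i).2.2.rank_le⟩⟩

/-- A certified decomposition of `⟨N⟩` with `R` terms restricts, for `n ≤ N`, to a decomposition
of `matMulTensor ℂ n n n` into `R` triads with all probe ranks `≤ ρ` (zero-padding monotonicity:
the probes of the restricted scheme are submatrices of the original probes). -/
theorem HasDecomp.restrict {N R ρ n : ℕ} (h : HasDecomp (Fin N) (Fin R) ρ) (hn : n ≤ N) :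
    ∃ (w u v : Fin R → Fin n × Fin n → ℂ),
      matMulTensor ℂ n n n = ∑ i, triad (w i) (u i) (v i) ∧
      ∀ i, (Matrix.of fun p q => w i (p, q)).rank ≤ ρ ∧
        (Matrix.of fun p q => u i (p, q)).rank ≤ ρ ∧
        (Matrix.of fun p q => v i (p, q)).rank ≤ ρ :=
  (h.comap (Fin.castLE hn) (Fin.castLE_injective hn)).toFin

end FixedRankSaturation

end Summit.MatrixMultiplication.MatrixMultiplication.Theorems

end
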